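import Mathlib
import HarnessLib
import Summits.Ventures.LatticeQCDFlow.Scaling.AcceptanceVolumeDecayPi
import Summits.Ventures.LatticeQCDFlow.Scaling.AcceptanceVolumeCeilingRigidity
import Summits.Ventures.LatticeQCDFlow.Scaling.AcceptanceVolumeFloorRigidityIntegral

/-!
# LatticeQCDFlow / Scaling — rigidity of the Bhattacharyya ceiling on a GENERAL space:
# `acc(p, q) = (∫ √(p q))²` iff the flow is hit-or-miss almost everywhere

HONEST FRAMING: exact (Metropolis-corrected) sampling algorithms for lattice gauge theory;
figures of merit are autocorrelation/cost numbers at stated couplings and volumes; no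
continuum-physics claim.

Venture `LatticeQCDFlow` (cell pub-lqcd), topic `Scaling`; FANOUT row 3 (`s0-u1-a`, S0-B
implementation A, GEN-13).  NEW WORK of the cell (elementary measure theory); NO definition is
introduced.  Row 3's `Scaling/AcceptanceVolumeDecayPi` (GEN-12, imported) proved the ceiling
`acc(p, q) = ∫∫ min(p(a)q(b), p(b)q(a)) ≤ (∫ √(p q))² = BC²` on any measure space, and row 3's finite
`Scaling/AcceptanceVolumeCeilingRigidity` (GEN-13, imported for the pointwise `min_eq_sqrt_mul_iff`)
its finite equality case; the pair kernel's integrability is row 3's `integrable_blockKernel`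
(`Scaling/AcceptanceVolumeFloorRigidityIntegral`, imported).  Here, for an s-finite reference measure `μ`, a normalised target `p ≥ 0`
and a positive model `q`, with "hit-or-miss a.e." spelled `∃ c, ∀ᵐ x ∂μ, 0 < p x → p x / q x = c`:

* §1 `sq_integral_sqrt_sub_meanAccept_eq` — the DEFECT IDENTITY
  `BC² − acc = ∫ (√(p(a)q(a))√(p(b)q(b)) − min(p(a)q(b), p(b)q(a))) d(μ⊗μ)` with a nonnegative
  integrand (`√(p(a)q(a))√(p(b)q(b)) = √(A·A′)`, `A = p(a)q(b)`, `A′ = p(b)q(a)`);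
* §2 **`hitOrMiss_ae_of_meanAccept_eq_sq_integral_sqrt`** (`acc = BC² ⇒` for `μ⊗μ`-a.e. pair
  `A = A′ ∨ A = 0 ∨ A′ = 0`, `Measure.ae_ae_of_ae_prod`, a point of positive target mass) and
  **`meanAccept_eq_sq_integral_sqrt_of_hitOrMiss_ae`** (the converse, transporting the a.e. weight
  condition along the two projections);
* **`meanAccept_eq_sq_integral_sqrt_iff`** — `acc(p, q) = BC(p, q)² ↔` hit-or-miss a.e.;
  **`meanAccept_lt_sq_integral_sqrt`** — STRICT `acc < BC²` for every other flow.

Reading (value-free): on any configuration space the Bhattacharyya ceiling of the equilibrium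
acceptance — the upper rate `Σ log(1/BCᵢ²)` of the volume law — is attained only by all-or-nothing
flows; combined with row 3's floor rigidity, every flow with graded weights sits strictly inside
`(8/9)·ESS ≤ acc < BC²`.  NOT CLAIMED: the `Measure.pi` block form of the equality case; a
quantitative gap; any number of ours.
-/

namespace Summit.Ventures.LatticeQCDFlow.Theory2

open MeasureTheory Set Filter

variable {X : Type*} [MeasurableSpace X] {μ : Measure X} [SFinite μ] {p q : X → ℝ}

/-! ## §1 The defect identity -/

omit [MeasurableSpace X] [SFinite μ] in
/-- `√(p(a)q(a))·√(p(b)q(b)) = √(A·A′)` with `A = p(a)q(b)`, `A′ = p(b)q(a)`. [folklore] -/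
theorem sqrt_mul_sqrt_eq_sqrt_cross (hp0 : ∀ x, 0 ≤ p x) (hq0 : ∀ x, 0 < q x) (a b : X) :
    Real.sqrt (p a * q a) * Real.sqrt (p b * q b) = Real.sqrt (p a * q b * (p b * q a)) := by
  rw [← Real.sqrt_mul (mul_nonneg (hp0 a) (hq0 a).le)]
  ring_nf

omit [MeasurableSpace X] [SFinite μ] in
/-- The defect integrand is nonnegative. [folklore] -/
theorem pairKernel_le_sqrt_mul_sqrt (hp0 : ∀ x, 0 ≤ p x) (hq0 : ∀ x, 0 < q x) (z : X × X) :
    min (p z.1 * q z.2) (p z.2 * q z.1) ≤ Real.sqrt (p z.1 * q z.1) * Real.sqrt (p z.2 * q z.2) := by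
  rw [sqrt_mul_sqrt_eq_sqrt_cross hp0 hq0]
  exact Real.le_sqrt_of_sq_le (Scoring.min_sq_le_mul (mul_nonneg (hp0 _) (hq0 _).le)
    (mul_nonneg (hp0 _) (hq0 _).le))

/-- **The defect identity**: `BC² − acc = ∫ (√(p(a)q(a))√(p(b)q(b)) − min(p(a)q(b), p(b)q(a))) d(μ⊗μ)`.
[ours] -/
theorem sq_integral_sqrt_sub_meanAccept_eq (hp0 : ∀ x, 0 ≤ p x) (hpm : Measurable p)
    (hpi : Integrable p μ) (hq0 : ∀ x, 0 < q x) (hqm : Measurable q) (hqi : Integrable q μ) :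
    (∫ a, Real.sqrt (p a * q a) ∂μ) ^ 2 - ∫ a, ∫ b, min (p a * q b) (p b * q a) ∂μ ∂μ
      = ∫ z, (Real.sqrt (p z.1 * q z.1) * Real.sqrt (p z.2 * q z.2)
          - min (p z.1 * q z.2) (p z.2 * q z.1)) ∂(μ.prod μ) := by
  have hfi := integrable_sqrt_mul hp0 hpm hpi (fun x => (hq0 x).le) hqm hqi
  rw [integral_sub (hfi.mul_prod hfi) (integrable_blockKernel hp0 hpm hpi hq0 hqm hqi),
    integral_prod_mul (fun a => Real.sqrt (p a * q a)) (fun b => Real.sqrt (p b * q b)),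
    integral_prod _ (integrable_blockKernel hp0 hpm hpi hq0 hqm hqi), sq]

/-! ## §2 `acc = BC²` iff hit-or-miss almost everywhere -/

/-- **`acc = BC² ⇒` hit-or-miss a.e.** [ours] -/
theorem hitOrMiss_ae_of_meanAccept_eq_sq_integral_sqrt (hp0 : ∀ x, 0 ≤ p x) (hpm : Measurable p)
    (hpi : Integrable p μ) (hp1 : ∫ x, p x ∂μ = 1) (hq0 : ∀ x, 0 < q x) (hqm : Measurable q)
    (hqi : Integrable q μ)
    (h : ∫ a, ∫ b, min (p a * q b) (p b * q a) ∂μ ∂μ = (∫ a, Real.sqrt (p a * q a) ∂μ) ^ 2) :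
    ∃ c : ℝ, ∀ᵐ x ∂μ, 0 < p x → p x / q x = c := by
  have hfi := integrable_sqrt_mul hp0 hpm hpi (fun x => (hq0 x).le) hqm hqi
  have hD : ∫ z, (Real.sqrt (p z.1 * q z.1) * Real.sqrt (p z.2 * q z.2)
      - min (p z.1 * q z.2) (p z.2 * q z.1)) ∂(μ.prod μ) = 0 := by
    rw [← sq_integral_sqrt_sub_meanAccept_eq hp0 hpm hpi hq0 hqm hqi, h, sub_self]
  have hnn : 0 ≤ fun z : X × X => Real.sqrt (p z.1 * q z.1) * Real.sqrt (p z.2 * q z.2)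
      - min (p z.1 * q z.2) (p z.2 * q z.1) :=
    fun z => sub_nonneg.2 (pairKernel_le_sqrt_mul_sqrt hp0 hq0 z)
  have hint : Integrable (fun z : X × X => Real.sqrt (p z.1 * q z.1) * Real.sqrt (p z.2 * q z.2)
      - min (p z.1 * q z.2) (p z.2 * q z.1)) (μ.prod μ) :=
    (hfi.mul_prod hfi).sub (integrable_blockKernel hp0 hpm hpi hq0 hqm hqi)
  have hae := (integral_eq_zero_iff_of_nonneg hnn hint).1 hD
  -- for a.e. `a`, for a.e. `b`: `A = A′ ∨ A = 0 ∨ A′ = 0`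
  have hxy : ∀ᵐ a ∂μ, ∀ᵐ b ∂μ,
      p a * q b = p b * q a ∨ p a * q b = 0 ∨ p b * q a = 0 := by
    refine (Measure.ae_ae_of_ae_prod hae).mono fun a ha => ha.mono fun b hb => ?_
    have hb' : Real.sqrt (p a * q a) * Real.sqrt (p b * q b) - min (p a * q b) (p b * q a) = 0 := hb
    rw [sqrt_mul_sqrt_eq_sqrt_cross hp0 hq0, sub_eq_zero, eq_comm] at hb'
    exact (min_eq_sqrt_mul_iff (mul_nonneg (hp0 _) (hq0 _).le) (mul_nonneg (hp0 _) (hq0 _).le)).1 hb'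
  -- a point of the full-measure set carrying positive target mass
  obtain ⟨a₀, ha₀p, ha₀⟩ : ∃ a₀, 0 < p a₀ ∧ ∀ᵐ b ∂μ,
      p a₀ * q b = p b * q a₀ ∨ p a₀ * q b = 0 ∨ p b * q a₀ = 0 := by
    by_contra hne
    have hp0ae : p =ᵐ[μ] 0 := by
      refine hxy.mono fun a ha => ?_
      have : ¬ 0 < p a := fun hpa => hne ⟨a, hpa, ha⟩
      exact le_antisymm (not_lt.mp this) (hp0 a)
    have : ∫ x, p x ∂μ = 0 := by rw [integral_congr_ae hp0ae]; simp
    rw [hp1] at this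
    exact one_ne_zero this
  refine ⟨p a₀ / q a₀, ha₀.mono fun b hb hpb => ?_⟩
  rcases hb with e | e | e
  · rw [div_eq_div_iff (hq0 b).ne' (hq0 a₀).ne']
    linarith
  · exact absurd e (mul_pos ha₀p (hq0 b)).ne'
  · exact absurd e (mul_pos hpb (hq0 a₀)).ne'

omit [MeasurableSpace X] [SFinite μ] in
/-- Weight conditions at the two states give the pointwise equality case. [ours] -/
theorem pairKernel_eq_sqrt_mul_sqrt_of_weights (hp0 : ∀ x, 0 ≤ p x) (hq0 : ∀ x, 0 < q x) {c : ℝ}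
    {a b : X} (ha : 0 < p a → p a / q a = c) (hb : 0 < p b → p b / q b = c) :
    min (p a * q b) (p b * q a) = Real.sqrt (p a * q a) * Real.sqrt (p b * q b) := by
  rw [sqrt_mul_sqrt_eq_sqrt_cross hp0 hq0,
    min_eq_sqrt_mul_iff (mul_nonneg (hp0 _) (hq0 _).le) (mul_nonneg (hp0 _) (hq0 _).le)]
  by_cases hpa : p a = 0
  · exact Or.inr (Or.inl (by rw [hpa, zero_mul]))
  by_cases hpb : p b = 0
  · exact Or.inr (Or.inr (by rw [hpb, zero_mul]))
  have h := (ha ((hp0 a).lt_of_ne' hpa)).trans (hb ((hp0 b).lt_of_ne' hpb)).symm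
  rw [div_eq_div_iff (hq0 a).ne' (hq0 b).ne'] at h
  exact Or.inl h

/-- **Hit-or-miss a.e. `⇒ acc = BC²`.** [ours] -/
theorem meanAccept_eq_sq_integral_sqrt_of_hitOrMiss_ae (hp0 : ∀ x, 0 ≤ p x) (hpm : Measurable p)
    (hpi : Integrable p μ) (hq0 : ∀ x, 0 < q x) (hqm : Measurable q) (hqi : Integrable q μ)
    (h : ∃ c : ℝ, ∀ᵐ x ∂μ, 0 < p x → p x / q x = c) :
    ∫ a, ∫ b, min (p a * q b) (p b * q a) ∂μ ∂μ = (∫ a, Real.sqrt (p a * q a) ∂μ) ^ 2 := by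
  obtain ⟨c, hc⟩ := h
  refine (sub_eq_zero.1 ?_).symm
  rw [sq_integral_sqrt_sub_meanAccept_eq hp0 hpm hpi hq0 hqm hqi]
  have h12 : ∀ᵐ z ∂(μ.prod μ), (0 < p z.1 → p z.1 / q z.1 = c) ∧ (0 < p z.2 → p z.2 / q z.2 = c) :=
    ((Measure.quasiMeasurePreserving_fst (μ := μ) (ν := μ)).ae hc).and
      ((Measure.quasiMeasurePreserving_snd (μ := μ) (ν := μ)).ae hc)
  have hae : (fun z : X × X => Real.sqrt (p z.1 * q z.1) * Real.sqrt (p z.2 * q z.2)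
      - min (p z.1 * q z.2) (p z.2 * q z.1)) =ᵐ[μ.prod μ] fun _ => (0 : ℝ) := by
    filter_upwards [h12] with z hz
    rw [← pairKernel_eq_sqrt_mul_sqrt_of_weights hp0 hq0 hz.1 hz.2, sub_self]
  rw [integral_congr_ae hae, integral_zero]

/-- **RIGIDITY OF THE BHATTACHARYYA CEILING ON A GENERAL SPACE**: for a normalised nonnegative target
and a positive model on any s-finite measure space, `acc(p, q) = (∫ √(p q))²` iff the flow is
hit-or-miss almost everywhere. [ours] -/
theorem meanAccept_eq_sq_integral_sqrt_iff (hp0 : ∀ x, 0 ≤ p x) (hpm : Measurable p)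
    (hpi : Integrable p μ) (hp1 : ∫ x, p x ∂μ = 1) (hq0 : ∀ x, 0 < q x) (hqm : Measurable q)
    (hqi : Integrable q μ) :
    ∫ a, ∫ b, min (p a * q b) (p b * q a) ∂μ ∂μ = (∫ a, Real.sqrt (p a * q a) ∂μ) ^ 2 ↔
      ∃ c : ℝ, ∀ᵐ x ∂μ, 0 < p x → p x / q x = c :=
  ⟨hitOrMiss_ae_of_meanAccept_eq_sq_integral_sqrt hp0 hpm hpi hp1 hq0 hqm hqi,
    meanAccept_eq_sq_integral_sqrt_of_hitOrMiss_ae hp0 hpm hpi hq0 hqm hqi⟩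

/-- **STRICT Bhattacharyya ceiling** for every flow that is not hit-or-miss a.e.:
`acc(p, q) < (∫ √(p q))²`. [ours] -/
theorem meanAccept_lt_sq_integral_sqrt (hp0 : ∀ x, 0 ≤ p x) (hpm : Measurable p)
    (hpi : Integrable p μ) (hp1 : ∫ x, p x ∂μ = 1) (hq0 : ∀ x, 0 < q x) (hqm : Measurable q)
    (hqi : Integrable q μ) (h : ¬ ∃ c : ℝ, ∀ᵐ x ∂μ, 0 < p x → p x / q x = c) :
    ∫ a, ∫ b, min (p a * q b) (p b * q a) ∂μ ∂μ < (∫ a, Real.sqrt (p a * q a) ∂μ) ^ 2 :=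
  lt_of_le_of_ne (meanAccept_le_sq_integral_sqrt hp0 hpm hpi (fun x => (hq0 x).le) hqm hqi)
    fun heq => h ((meanAccept_eq_sq_integral_sqrt_iff hp0 hpm hpi hp1 hq0 hqm hqi).1 heq)

end Summit.Ventures.LatticeQCDFlow.Theory2
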